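import Summits.BirchSwinnertonDyer.BirchSwinnertonDyer.Theorems.SignedLowerHalvesSmallImageLowerHalfBothSignsRttD2TwistLevel
import HarnessLib

/-!
# Route `SignedLowerHalves`, crux L `SmallImageLowerHalfBothSigns` (stmt-BirchSwinnertonDyer-23599), line `rtt_w3` v14 — E2, row «D-tw-coh» part 1b(ii):
# the level twist is `𝒪`-linear and compatible with the reductions in `k`

INPUTS hand `bsd-inputs-honda-p1` g23 (LEAD g11 RULING «U» (U5); sequel of `…RttD2TwistLevel` (part 1a: `levelTwistO`) and `…RttD2TwistLevelInverse`
(part 1b(i): `levelTwistEquivO`)). For characters `θ, θ'` congruent mod `p^k` on the level subgroup `U` and on `N_P`: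
* ★ `levelTwistO_map_levelMapHomO` — the twist commutes with every pair of equivariant coefficient maps with the same underlying map (both composites are
  `H^i` of one coefficient morphism); hence ★ `levelTwistO_levelRedO` (reductions `𝒪 ⊗ μ_{p^{k+1}} → 𝒪 ⊗ μ_{p^k}`) and ★ `levelTwistO_levelScalarO`
  (constants `H^i(c ⊗ id)`: the twist is `𝒪`-linear).
NOT here (part 2 of «D-tw-coh», L): naturality with the corestrictions `relCoresO`, the conj-SEMILINEARITY by `η(γ)`, and the cofinal assembly on the pinned data.
THEOREMS only; no `def`, no named fact, no `sorry`; crux L, crux M, E2 and BSD remain OPEN and are proved for NO curve by any of this.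
Engineering note (for sequels): one `ContinuousCohomology.map` square per file — each decl at the level of `TopRep` morphisms costs ≈ 100–150 s of farm
elaboration; always pass `(X := …) (Y := …)` to `ContinuousCohomology.map` in statements, and move morphism equalities by `congrArg`, not `rw`.
References: [SerreGaloisCohomology1997] I §2.2; [Kato2004Asterisque] §8.2 (p. 180); [JohnsonLeungKings2011] §4.1–§4.2.
-/

set_option autoImplicit false
-- the Theorems namespace of this sub repeats the summit name by design (D-0017 nested layout)
set_option linter.dupNamespace false

noncomputable section

open scoped NumberField TensorProduct
open CategoryTheory Field IsDedekindDomain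
open Literature.NumberTheory.GaloisRepresentations
open Literature.NumberTheory.GaloisRepresentations.DiscreteGaloisModule
open Literature.NumberTheory.EllipticCurves
open Literature.NumberTheory.ComplexMultiplication.EllipticUnits
open Literature.NumberTheory.ComplexMultiplication.EllipticUnits.JohnsonLeungKings2011

namespace Summit.BirchSwinnertonDyer.BirchSwinnertonDyer.Theorems.SmallImageRttD2Twist

variable {K : Type} [Field K] [NumberField K] {p : ℕ} [Fact p.Prime] (S : Set (PadicAlgCl p))
  (P : Set (HeightOneSpectrum (𝓞 K))) (θ θ' : absoluteGaloisGroup K →ₜ* (padicCoeffIntegers S)ˣ) (k : ℕ)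
  (hN : ∀ σ ∈ ramificationSubgroup K P, ∃ b : padicCoeffIntegers S,
    ((θ' σ : (padicCoeffIntegers S)ˣ) : padicCoeffIntegers S) = (θ σ : (padicCoeffIntegers S)ˣ) + ((p : padicCoeffIntegers S)) ^ k * b)
  (U : Subgroup (absoluteGaloisGroup K))
  (hU : ∀ σ ∈ U, ∃ b : padicCoeffIntegers S,
    ((θ' σ : (padicCoeffIntegers S)ˣ) : padicCoeffIntegers S) = (θ σ : (padicCoeffIntegers S)ˣ) + ((p : padicCoeffIntegers S)) ^ k * b)

/-! ## §3 Naturality in the coefficient maps: reductions and constants -/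

set_option maxHeartbeats 400000 in
omit [NumberField K] in
/-- **The twist commutes with every pair of `Γ_K`-equivariant coefficient maps intertwined by the identity** (`f' ∘ id = id ∘ f` on vectors): for `θ`-equivariant `f`
and `θ'`-equivariant `f'` with the same underlying map, `tw ∘ H^i(f) = H^i(f') ∘ tw` (both composites are `H^i` of the same coefficient morphism).
[cite: SerreGaloisCohomology1997, I §2.2] -/
theorem levelTwistO_map_levelMapHomO {k' : ℕ}
    (hN' : ∀ σ ∈ ramificationSubgroup K P, ∃ b : padicCoeffIntegers S,
      ((θ' σ : (padicCoeffIntegers S)ˣ) : padicCoeffIntegers S) = (θ σ : (padicCoeffIntegers S)ˣ) + ((p : padicCoeffIntegers S)) ^ k' * b)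
    (hU' : ∀ σ ∈ U, ∃ b : padicCoeffIntegers S,
      ((θ' σ : (padicCoeffIntegers S)ˣ) : padicCoeffIntegers S) = (θ σ : (padicCoeffIntegers S)ˣ) + ((p : padicCoeffIntegers S)) ^ k' * b)
    (i : ℕ) (f : OMuCarrier K S (p ^ k) →+ OMuCarrier K S (p ^ k'))
    (hf : ∀ (σ : absoluteGaloisGroup K) (x : OMuCarrier K S (p ^ k)), f (muTwistO S θ k σ x) = muTwistO S θ k' σ (f x))
    (hf' : ∀ (σ : absoluteGaloisGroup K) (x : OMuCarrier K S (p ^ k)), f (muTwistO S θ' k σ x) = muTwistO S θ' k' σ (f x))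
    (y : levelCohO S P θ U k i) :
    levelTwistO S P θ θ' k' hN' U hU' i
        ((ContinuousCohomology.map (ContinuousMonoidHom.id _) (X := (levelRepO S P θ U k).toTopRep) (Y := (levelRepO S P θ U k').toTopRep)
          (levelMapHomO S P θ U f hf) i).hom y) =
      (ContinuousCohomology.map (ContinuousMonoidHom.id _) (X := (levelRepO S P θ' U k).toTopRep) (Y := (levelRepO S P θ' U k').toTopRep)
          (levelMapHomO S P θ' U f hf') i).hom (levelTwistO S P θ θ' k hN U hU i y) := by
  have hsq : levelMapHomO S P θ U f hf ≫ twistLevelHomO S P θ θ' k' hN' U hU' = twistLevelHomO S P θ θ' k hN U hU ≫ levelMapHomO S P θ' U f hf' :=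
    TopRep.hom_ext (ContIntertwiningMap.ext (ContinuousLinearMap.ext fun x ↦ Subtype.ext rfl))
  -- `H^i` of the two composites (functoriality in the coefficients); the square `hsq` is transported by `congrArg` (never by `rw`: the lemma's
  -- composite lives at the object `TopRep.res (id) X`, definitionally but not syntactically `X`)
  have h1 := continuousCohomology_map_comp (levelMapHomO S P θ U f hf) (twistLevelHomO S P θ θ' k' hN' U hU') i
  have h2 := continuousCohomology_map_comp (twistLevelHomO S P θ θ' k hN U hU) (levelMapHomO S P θ' U f hf') i
  have h3 := congrArg (fun F ↦ ContinuousCohomology.map (ContinuousMonoidHom.id (↥(imGS P U)))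
      (X := (levelRepO S P θ U k).toTopRep) (Y := (levelRepO S P θ' U k').toTopRep) F i) hsq
  exact congrArg (fun φ ↦ φ.hom y) ((h1.symm.trans h3).trans h2)

omit [NumberField K] in
/-- ★ **The twist commutes with the reductions `𝒪 ⊗ μ_{p^{k+1}} → 𝒪 ⊗ μ_{p^k}`** (congruence mod `p^{k+1}` on `U`, `N_P` implies it mod `p^k`).
[cite: Kato2004Asterisque, §8.2 (p. 180)] [cite: SerreGaloisCohomology1997, I §2.2] -/
theorem levelTwistO_levelRedO
    (hN₁ : ∀ σ ∈ ramificationSubgroup K P, ∃ b : padicCoeffIntegers S,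
      ((θ' σ : (padicCoeffIntegers S)ˣ) : padicCoeffIntegers S) = (θ σ : (padicCoeffIntegers S)ˣ) + ((p : padicCoeffIntegers S)) ^ (k + 1) * b)
    (hU₁ : ∀ σ ∈ U, ∃ b : padicCoeffIntegers S,
      ((θ' σ : (padicCoeffIntegers S)ˣ) : padicCoeffIntegers S) = (θ σ : (padicCoeffIntegers S)ˣ) + ((p : padicCoeffIntegers S)) ^ (k + 1) * b)
    (i : ℕ) (y : levelCohO S P θ U (k + 1) i) :
    levelTwistO S P θ θ' k hN U hU i (levelRedO S P θ U k i y) = levelRedO S P θ' U k i (levelTwistO S P θ θ' (k + 1) hN₁ U hU₁ i y) := by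
  rw [levelRedO_apply, levelRedO_apply]
  exact levelTwistO_map_levelMapHomO S P θ θ' (k + 1) hN₁ U hU₁ hN hU i (oMuRed S k) (oMuRed_muTwistO S θ k) (oMuRed_muTwistO S θ' k) y

omit [NumberField K] in
/-- ★ **The twist commutes with the constants `H^i(c ⊗ id)`** — it is `𝒪`-linear. [cite: JohnsonLeungKings2011, §4.1 Def. 4.1 (arXiv p0012:L59–60)] [cite: SerreGaloisCohomology1997, I §2.2] -/
theorem levelTwistO_levelScalarO (i : ℕ) (c : padicCoeffIntegers S) (y : levelCohO S P θ U k i) :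
    levelTwistO S P θ θ' k hN U hU i (levelScalarO S P θ U k i c y) = levelScalarO S P θ' U k i c (levelTwistO S P θ θ' k hN U hU i y) := by
  rw [levelScalarO_apply, levelScalarO_apply]
  exact levelTwistO_map_levelMapHomO S P θ θ' k hN U hU hN hU i (oMuScalar S (p ^ k) c) (oMuScalar_muTwistO S θ k c) (oMuScalar_muTwistO S θ' k c) y

end Summit.BirchSwinnertonDyer.BirchSwinnertonDyer.Theorems.SmallImageRttD2Twist

end
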